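import Literature.Probability.RandomPlanarGeometry.SAWPulledLargeForceExpansionZdBridgeFast
import HarnessLib

/-!
# «NO-SINGLETON ENGINE»: a lean kernel census of the self-avoiding words WITHOUT an axis used exactly once, in every dimension

Topic `Literature/Probability/RandomPlanarGeometry` (companion of the SINGLETON-AXIS RENEWAL IDENTITY `SAWCountZdSingletonAxisIdentity.lean`
(a-p3 g23): there `c_n(ℤ^d) = A_n(d) + Σ_{r≥1} (−1)^{r+1} 2^r d^{(r)} Σ_{ℓ₀+⋯+ℓ_r=n−r} Π c_{ℓ_j}(ℤ^{d−r})` with `A_n(d)` the number of `n`-step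
self-avoiding walks of `ℤ^d` with NO SINGLETON AXIS; here is the kernel engine that computes `A_n(d)` for every `d` at once, built from the lean state
of `…ZdBridgeFast` (#593's generic reduced search `dfsV` / `dfsN`, `card_eq_sum_dfsN_reduced` of `…ZdTenStep`, the key arithmetic `encS` /
`keyW` / `visW` / `memM_maskOf` of `…ZdBridgeFast`).  Why it pays: a word without singleton axes uses `≤ n/2` axes, and the prune «number of singleton
axes so far ≤ letters to go» keeps the search small (`A_{11}`: 4.6·10⁶ live nodes against 1.65·10⁷ for all self-avoiding eleven-letter words).

* §1 KERNEL SIDE: the state (`FA`: endpoint key, bitmask + list of earlier keys, ONCE/MULTI axis bitmasks, `c1 = #once`, letters to go), the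
  multiplicity step `stepA`, the evaluator ★ `fastA` / `fastAS` (children: old axes both signs, then the new axis positive — policy `alwR`), the
  machine `updA` / `okA` (endpoint new ∧ `c1 ≤` letters to go) / `clsA` (`c1 = 0 ∧ once = 0`) / `s0A`;
* §2 ★ `fastAS_eq_dfsV`: the evaluator IS the generic census `dfsV alwR updA okA clsA`;
* §3 SEMANTICS: `cntW` (letters on an axis among the first `i`), `mstate` (the bookkeeping folded along the word) and ★ `mstate_spec` (once-bit ⟺ count
  `= 1`, multi-bit ⟺ count `≥ 2`, counter = `#onceSet`), ★★ `st_updA_take` (the state along a word over `≤ 15` axes), ★★★ `okA_st_iff` (= the step-walk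
  test `okR` ∧ `#onceSet ≤ L − i`), `clsA_st_iff` (⟺ no axis count equals one);
* §4 THE CLASS: `NoSingF` (position form, a manifest type invariant), `noSingF_iff_cntW`, ★ PIGEONHOLE `card_onceSet_le` (no singleton at the end ⇒
  the prune never cuts), ★★★ `prefixOK_clsA_iff` (raw tests ⟺ self-avoiding ∧ no singleton axis), type/flip invariance, and ★★★
  `card_isSAW_noSingF_eq_sum` / `card_isSAW_noSingF_of_fastAS`: **`#{u : Word L d | self-avoiding, no singleton axis} = Σ_k 2^k a_k d^{(k)}` from ONE
  lean census value** (`L ≤ 15`);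
* §5 ASSEMBLY BY TABLE (as `…ZdBridgeFast` §4): `fastAT`, ★★ `fastAT_eq`, ★★★ `fastAS_root_eq_fastAT`, `tableA_ok_of`;
* §6 SELF-TEST in every dimension: ★ `card_isSAW_noSingF_six` — the six-step walks without a singleton axis number `2d + 348 d(d−1) + 504 d(d−1)(d−2)`
  (reduced counts `1, 87, 63` by `decide +kernel`; the lane's enumerator gives the same, kit j281565).
[cite: MadrasSlade1993, Definition 1.2.4; §1.1]
The definitions `stepA`, `fastA`, `FA`, `updA`, `okA`, `clsA`, `s0A`, `fastAS`, `cntW`, `mstate`, `onceSet`, `NoSingF`, `fastAT` are this file's tool notions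
(not notions in print).  No number is taken from print.

Provenance: lane «pcv-sawmu», a-p3 g23 (2026-08-27).
-/

open Finset
open scoped BigOperators
open Literature.Probability.LatticeModels
open Literature.Probability.RandomPlanarGeometry.SAW

namespace Literature.Probability.RandomPlanarGeometry.SAW.Zd

namespace WordTypes

/-! ### §1 Kernel side: the lean no-singleton state and its evaluator -/

section kernelside

/-- The multiplicity bookkeeping of one more letter on axis `a`: (once-mask, multi-mask, number of singleton axes). [cite: MadrasSlade1993, Definition 1.2.4] -/
def stepA (once multi c1 a : ℕ) : ℕ × ℕ × ℕ :=
  bif Nat.testBit multi a then (once, multi, c1)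
  else bif Nat.testBit once a then (Nat.xor once (2 ^ a), Nat.lor multi (2 ^ a), c1 - 1) else (Nat.lor once (2 ^ a), multi, c1 + 1)

/-- ★ THE LEAN EVALUATOR of the reduced no-singleton census of step words (what the kernel runs): `j` letters of fuel, endpoint key `k` (base `32`),
bitmask `mask` / list `vs` of the earlier keys, `m` axes so far, masks `once` / `multi` of the axes used exactly once / at least twice, `c1 = #once`,
`tg` letters to go; a node lives iff its endpoint is new AND `c1 ≤ tg` (every singleton axis needs one more letter); a leaf counts `B ^ m` iff moreover
`c1 = 0 ∧ once = 0`.  Children (policy `alwR`): old axes `a < m` both signs (keys `k ± 32^a`), then the new axis `m`, positive sign.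
[cite: MadrasSlade1993, Definition 1.2.4] -/
def fastA (B : ℕ) : ℕ → ℕ → ℕ → List ℕ → ℕ → ℕ → ℕ → ℕ → ℕ → ℕ
  | 0, k, mask, vs, m, once, _, c1, tg => bif (!(memM k mask vs) && Nat.ble c1 tg) && (Nat.beq c1 0 && Nat.beq once 0) then B ^ m else 0
  | j + 1, k, mask, vs, m, once, multi, c1, tg => bif !(memM k mask vs) && Nat.ble c1 tg then
      sumTo (fun a =>
          fastA B j (k + 32 ^ a) (Nat.lor mask (slot k)) (k :: vs) m (stepA once multi c1 a).1 (stepA once multi c1 a).2.1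
              (stepA once multi c1 a).2.2 (tg - 1) +
            fastA B j (k - 32 ^ a) (Nat.lor mask (slot k)) (k :: vs) m (stepA once multi c1 a).1 (stepA once multi c1 a).2.1
              (stepA once multi c1 a).2.2 (tg - 1)) m +
        fastA B j (k + 32 ^ m) (Nat.lor mask (slot k)) (k :: vs) (m + 1) (stepA once multi c1 m).1 (stepA once multi c1 m).2.1
          (stepA once multi c1 m).2.2 (tg - 1)
    else 0

/-- The lean no-singleton search state. [cite: MadrasSlade1993, Definition 1.2.4] -/
structure FA where
  /-- the key of the endpoint -/
  key : ℕ
  /-- the bitmask of the slots of the earlier keys -/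
  mask : ℕ
  /-- the earlier keys, most recent first -/
  vis : List ℕ
  /-- bitmask of the axes used exactly once so far -/
  once : ℕ
  /-- bitmask of the axes used at least twice so far -/
  multi : ℕ
  /-- the number of axes used exactly once so far -/
  c1 : ℕ
  /-- the number of letters still to come -/
  tg : ℕ

/-- State update by one raw letter. [cite: MadrasSlade1993, Definition 1.2.4] -/
def updA (s : FA) (a : ℕ × Bool) : FA :=
  ⟨newKey s.key a, Nat.lor s.mask (slot s.key), s.key :: s.vis, (stepA s.once s.multi s.c1 a.1).1, (stepA s.once s.multi s.c1 a.1).2.1,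
    (stepA s.once s.multi s.c1 a.1).2.2, s.tg - 1⟩

/-- The pruning test: endpoint new and no more singleton axes than letters to go. [cite: MadrasSlade1993, Definition 1.2.4] -/
def okA (s : FA) : Bool := !(memM s.key s.mask s.vis) && Nat.ble s.c1 s.tg

/-- One class: no singleton axis at the end. [cite: MadrasSlade1993, Definition 1.2.4] -/
def clsA : ℕ → FA → Bool
  | 0 => fun s => Nat.beq s.c1 0 && Nat.beq s.once 0
  | _ => fun _ => false

/-- The start state for words of length `L` over `≤ L` axes. [cite: MadrasSlade1993, Definition 1.2.4] -/
def s0A (L : ℕ) : FA := ⟨key0 L, 0, [], 0, 0, 0, L⟩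

/-- The evaluator on a packed state. [cite: MadrasSlade1993, Definition 1.2.4] -/
def fastAS (B j : ℕ) (s : FA) (m : ℕ) : ℕ := fastA B j s.key s.mask s.vis m s.once s.multi s.c1 s.tg

end kernelside

/-! ### §2 The evaluator is the generic census `dfsV` of the lean no-singleton machine -/

section evaluator

/-- ★ THE EVALUATOR IS THE CENSUS: `fastAS B j s m = dfsV alwR updA okA clsA 1 N B j s m`. [cite: MadrasSlade1993, Definition 1.2.4] -/
theorem fastAS_eq_dfsV (B N : ℕ) : ∀ (j : ℕ) (s : FA) (m : ℕ), fastAS B j s m = dfsV alwR updA okA clsA 1 N B j s m := by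
  intro j
  induction j with
  | zero =>
    intro s m
    simp only [fastAS, fastA, dfsV, leafV, okA, List.range_succ, List.range_zero, List.nil_append, List.foldr_cons,
      List.foldr_nil, clsA, Nat.mul_zero, Nat.zero_add]
    cases (!memM s.key s.mask s.vis && Nat.ble s.c1 s.tg) <;> cases (Nat.beq s.c1 0 && Nat.beq s.once 0) <;> simp
  | succ j ih =>
    intro s m
    have hok : (!memM s.key s.mask s.vis && Nat.ble s.c1 s.tg) = okA s := rfl
    rw [dfsV]
    by_cases h : okA s = true
    · rw [if_pos h, foldr_lts_alwR]
      simp only [← ih]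
      rw [fastAS, fastA, hok, h, cond_true]
      have hch : ∀ (a : ℕ) (b : Bool), fastAS B j (updA s (a, b)) (nxt m (a, b)) =
          fastA B j (bif b then s.key + 32 ^ a else s.key - 32 ^ a) (Nat.lor s.mask (slot s.key)) (s.key :: s.vis) (nxt m (a, b))
            (stepA s.once s.multi s.c1 a).1 (stepA s.once s.multi s.c1 a).2.1 (stepA s.once s.multi s.c1 a).2.2 (s.tg - 1) := by
        intro a b; cases b <;> simp [fastAS, updA, newKey]
      rw [hch, nxt_self, cond_true, sumTo_eq_sum]
      congr 1
      refine Finset.sum_congr rfl fun a ha => ?_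
      have ha' : a < m := Finset.mem_range.1 ha
      rw [hch, hch, nxt_of_lt ha', nxt_of_lt ha']
      rfl
    · have h' : okA s = false := by simpa using h
      rw [if_neg h, fastAS, fastA, hok, h', cond_false]

end evaluator

/-! ### §3 Semantics: along a word the lean state is (key of the endpoint, keys of the earlier points, the multiplicity bookkeeping, letters to go) -/

section semantics

variable {L : ℕ}

/-- The number of letters on axis `a` among the first `i` letters of `τ`. [cite: MadrasSlade1993, Definition 1.2.4] -/
def cntW (τ : Word L L) (i a : ℕ) : ℕ := (Finset.univ.filter fun p : Fin L => p.val < i ∧ (τ p).1.val = a).card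

/-- The multiplicity bookkeeping after `i` letters: `stepA` folded along the word. [cite: MadrasSlade1993, Definition 1.2.4] -/
def mstate (τ : Word L L) : ℕ → ℕ × ℕ × ℕ
  | 0 => (0, 0, 0)
  | i + 1 => if h : i < L then stepA (mstate τ i).1 (mstate τ i).2.1 (mstate τ i).2.2 (τ ⟨i, h⟩).1.val else mstate τ i

/-- The singleton axes after `i` letters. [cite: MadrasSlade1993, Definition 1.2.4] -/
def onceSet (τ : Word L L) (i : ℕ) : Finset ℕ := (Finset.range L).filter fun a => cntW τ i a = 1

/-- One more letter: the count on its axis goes up by one, the others stay. [cite: MadrasSlade1993, Definition 1.2.4] -/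
theorem cntW_succ (τ : Word L L) {i : ℕ} (hi : i < L) (a : ℕ) :
    cntW τ (i + 1) a = cntW τ i a + (if (τ ⟨i, hi⟩).1.val = a then 1 else 0) := by
  unfold cntW
  have hsplit : (Finset.univ.filter fun p : Fin L => p.val < i + 1 ∧ (τ p).1.val = a) =
      (Finset.univ.filter fun p : Fin L => p.val < i ∧ (τ p).1.val = a) ∪
        (if (τ ⟨i, hi⟩).1.val = a then {⟨i, hi⟩} else ∅) := by
    ext p
    simp only [Finset.mem_filter, Finset.mem_univ, true_and, Finset.mem_union]
    constructor
    · rintro ⟨hp, hpa⟩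
      rcases Nat.lt_succ_iff_lt_or_eq.1 hp with h | h
      · exact Or.inl ⟨h, hpa⟩
      · right
        have : p = ⟨i, hi⟩ := Fin.ext h
        subst this
        rw [if_pos hpa]; exact Finset.mem_singleton_self _
    · rintro (⟨h, hpa⟩ | h)
      · exact ⟨Nat.lt_succ_of_lt h, hpa⟩
      · split_ifs at h with hx
        · rw [Finset.mem_singleton] at h; subst h; exact ⟨Nat.lt_succ_self i, hx⟩
        · simp at h
  rw [hsplit, Finset.card_union_of_disjoint]
  · split_ifs <;> simp
  · split_ifs
    · simp only [Finset.disjoint_singleton_right, Finset.mem_filter, Finset.mem_univ, true_and, not_and]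
      intro h; exact absurd h (lt_irrefl i)
    · exact Finset.disjoint_empty_right _

/-- No letters, no counts. [cite: MadrasSlade1993, Definition 1.2.4] -/
theorem cntW_zero (τ : Word L L) (a : ℕ) : cntW τ 0 a = 0 := by
  unfold cntW; simp

/-- `testBit` of `stepA`'s masks, spelled out. [cite: MadrasSlade1993, Definition 1.2.4] -/
theorem testBit_two_pow' (x a : ℕ) : (2 ^ x).testBit a = decide (x = a) := by
  rw [Nat.testBit_two_pow]

/-- ★ THE BOOKKEEPING IS RIGHT: after `i ≤ L` letters, bit `a` of the once-mask says «axis `a` used exactly once», bit `a` of the multi-mask says «at least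
twice», and the counter is the number of singleton axes. [cite: MadrasSlade1993, Definition 1.2.4] -/
theorem mstate_spec (τ : Word L L) : ∀ i, i ≤ L →
    (∀ a, (mstate τ i).1.testBit a = decide (cntW τ i a = 1)) ∧ (∀ a, (mstate τ i).2.1.testBit a = decide (2 ≤ cntW τ i a)) ∧
      (mstate τ i).2.2 = (onceSet τ i).card := by
  intro i
  induction i with
  | zero =>
    intro _
    refine ⟨fun a => ?_, fun a => ?_, ?_⟩
    · rw [mstate, Nat.zero_testBit, cntW_zero]; rfl
    · rw [mstate, Nat.zero_testBit, cntW_zero]; rfl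
    · rw [mstate, onceSet]; simp [cntW_zero]
  | succ i ih =>
    intro hi
    have hi' : i < L := hi
    obtain ⟨h1, h2, h3⟩ := ih hi'.le
    set x := (τ ⟨i, hi'⟩).1.val with hx
    have hxL : x < L := (τ ⟨i, hi'⟩).1.isLt
    have hm : mstate τ (i + 1) = stepA (mstate τ i).1 (mstate τ i).2.1 (mstate τ i).2.2 x := by rw [mstate, dif_pos hi']
    have hc : ∀ a, cntW τ (i + 1) a = cntW τ i a + (if x = a then 1 else 0) := fun a => cntW_succ τ hi' a
    -- the three cases of `stepA`
    rw [hm, stepA]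
    by_cases hmul : (mstate τ i).2.1.testBit x = true
    · -- axis `x` already used at least twice
      have hcx : 2 ≤ cntW τ i x := by simpa [h2 x] using hmul
      rw [hmul, cond_true]
      refine ⟨fun a => ?_, fun a => ?_, ?_⟩
      · rw [h1 a, hc a]
        by_cases hxa : x = a
        · subst hxa; rw [if_pos rfl]; simp only [decide_eq_decide]; omega
        · rw [if_neg hxa, add_zero]
      · rw [h2 a, hc a]
        by_cases hxa : x = a
        · subst hxa; rw [if_pos rfl]; simp only [decide_eq_decide]; omega
        · rw [if_neg hxa, add_zero]
      · rw [h3]; unfold onceSet; congr 1; ext a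
        simp only [Finset.mem_filter, Finset.mem_range, hc a]
        by_cases hxa : x = a
        · subst hxa; simp; omega
        · simp [hxa]
    · have hmul' : (mstate τ i).2.1.testBit x = false := by simpa using hmul
      have hcx2 : cntW τ i x < 2 := by have := h2 x; rw [hmul'] at this; simpa using this
      rw [hmul', cond_false]
      by_cases hone : (mstate τ i).1.testBit x = true
      · -- axis `x` was a singleton: it becomes a double
        have hcx : cntW τ i x = 1 := by simpa [h1 x] using hone
        rw [hone, cond_true]
        refine ⟨fun a => ?_, fun a => ?_, ?_⟩
        · show (Nat.xor (mstate τ i).1 (2 ^ x)).testBit a = _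
          rw [show Nat.xor (mstate τ i).1 (2 ^ x) = (mstate τ i).1 ^^^ 2 ^ x from rfl, Nat.testBit_xor, h1 a, testBit_two_pow', hc a]
          by_cases hxa : x = a
          · subst hxa; simp [hcx]
          · simp [hxa]
        · show (Nat.lor (mstate τ i).2.1 (2 ^ x)).testBit a = _
          rw [show Nat.lor (mstate τ i).2.1 (2 ^ x) = (mstate τ i).2.1 ||| 2 ^ x from rfl, Nat.testBit_lor, h2 a, testBit_two_pow', hc a]
          by_cases hxa : x = a
          · subst hxa; simp [hcx]
          · simp [hxa]
        · show (mstate τ i).2.2 - 1 = _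
          have hxmem : x ∈ onceSet τ i := by unfold onceSet; simp [hxL, hcx]
          have hset : onceSet τ (i + 1) = (onceSet τ i).erase x := by
            unfold onceSet; ext a
            simp only [Finset.mem_filter, Finset.mem_range, Finset.mem_erase, hc a]
            by_cases hxa : x = a
            · subst hxa; simp [hcx]
            · simp [hxa, Ne.symm hxa]
          rw [h3, hset, Finset.card_erase_of_mem hxmem]
      · -- axis `x` is new: it becomes a singleton
        have hone' : (mstate τ i).1.testBit x = false := by simpa using hone
        have hcx : cntW τ i x = 0 := by
          have := h1 x; rw [hone'] at this
          have h' : cntW τ i x ≠ 1 := by simpa using this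
          omega
        rw [hone', cond_false]
        refine ⟨fun a => ?_, fun a => ?_, ?_⟩
        · show (Nat.lor (mstate τ i).1 (2 ^ x)).testBit a = _
          rw [show Nat.lor (mstate τ i).1 (2 ^ x) = (mstate τ i).1 ||| 2 ^ x from rfl, Nat.testBit_lor, h1 a, testBit_two_pow', hc a]
          by_cases hxa : x = a
          · subst hxa; simp [hcx]
          · simp [hxa]
        · show (mstate τ i).2.1.testBit a = _
          rw [h2 a, hc a]
          by_cases hxa : x = a
          · subst hxa; simp [hcx]
          · simp [hxa]
        · show (mstate τ i).2.2 + 1 = _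
          have hxnot : x ∉ onceSet τ i := by unfold onceSet; simp [hcx]
          have hset : onceSet τ (i + 1) = insert x (onceSet τ i) := by
            unfold onceSet; ext a
            simp only [Finset.mem_filter, Finset.mem_range, Finset.mem_insert, hc a]
            by_cases hxa : x = a
            · subst hxa; simp [hcx, hxL]
            · simp [hxa, Ne.symm hxa]
          rw [h3, hset, Finset.card_insert_of_notMem hxnot]

/-- ★★ THE LEAN NO-SINGLETON STATE ALONG A WORD: after `i ≤ L` letters of a word `τ` over `L ≤ 15` axes the state is (key of the endpoint, bitmask and
list of the earlier keys, the multiplicity bookkeeping `mstate τ i`, `L − i` letters to go). [cite: MadrasSlade1993, Definition 1.2.4] -/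
theorem st_updA_take (hL : L ≤ 15) (τ : Word L L) : ∀ i, i ≤ L →
    st updA (s0A L) ((rawW τ).take i) =
      ⟨keyW τ i, maskOf (visW τ i), visW τ i, (mstate τ i).1, (mstate τ i).2.1, (mstate τ i).2.2, L - i⟩ := by
  intro i
  induction i with
  | zero =>
    intro _
    simp only [List.take_zero, st, List.foldl_nil, s0A, keyW, bsumW_self, encS_zero, visW, List.range_zero, maskOf, mstate,
      List.map_nil, List.reverse_nil, Nat.sub_zero]
  | succ i ih =>
    intro hi
    have hi' : i < L := hi
    rw [rawW_take_succ τ i hi', st_append_singleton, ih hi'.le, updA, visW_succ, maskOf, keyW, keyW, bsumW_succ τ (Nat.zero_le i) hi',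
      encS_add_twoStepV]
    · simp only [mstate, dif_pos hi', raw]
      congr 1
    · have hb := (bsumW_zero_bounds τ i hi'.le (τ ⟨i, hi'⟩).1.succ).1
      omega

/-- ★★★ THE LEAN TEST ALONG A WORD: at every prefix of a word over `L ≤ 15` axes, `okA` holds iff the endpoint is new among the earlier points (the
step-walk test `okR`) AND the number of singleton axes is at most the number of letters to go. [cite: MadrasSlade1993, Definition 1.2.4] -/
theorem okA_st_iff (hL : L ≤ 15) (τ : Word L L) (i : ℕ) (hi : i ≤ L) :
    okA (st updA (s0A L) ((rawW τ).take i)) = true ↔ okR L (st updR [] ((rawW τ).take i)) = true ∧ (onceSet τ i).card ≤ L - i := by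
  rw [st_updA_take hL τ i hi, okA, Bool.and_eq_true, Nat.ble_eq, (mstate_spec τ i hi).2.2, memM_maskOf]
  refine and_congr_left fun _ => ?_
  -- the self-avoidance conjunct (as in `okF_st_eq_okT`)
  rw [Bool.not_eq_true', okR_st_iff τ hi, ← Bool.not_eq_true, memN_iff]
  simp only [visW, List.mem_reverse, List.mem_map, List.mem_range, not_exists, not_and]
  constructor
  · intro h j hj0 hji hz
    refine h (i - j) (by omega) ?_
    rw [keyW, keyW, bsumW_add τ (Nat.zero_le _) (Nat.sub_le i j) hi, hz, add_zero]
  · intro h j hji hk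
    have hinj := encS_injective_of_bounds L (bsumW_apply_zero τ 0 j) (bsumW_apply_zero τ 0 i)
      (fun b => by have := bsumW_zero_bounds τ j (by omega) b; omega)
      (fun b => by have := bsumW_zero_bounds τ i hi b; omega) hk
    refine h (i - j) (by omega) (by omega) ?_
    have hs := bsumW_add τ (Nat.zero_le _) hji.le hi
    rw [show i - (i - j) = j by omega]
    rw [hinj] at hs
    exact left_eq_add.1 hs

/-- At the end of the word the class test says: no singleton axis. [cite: MadrasSlade1993, Definition 1.2.4] -/
theorem clsA_st_iff (hL : L ≤ 15) (τ : Word L L) :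
    clsA 0 (st updA (s0A L) (rawW τ)) = true ↔ ∀ a, cntW τ L a ≠ 1 := by
  have e : (rawW τ).take L = rawW τ := List.take_of_length_le (by simp [rawW])
  obtain ⟨h1, -, h3⟩ := mstate_spec τ L le_rfl
  rw [← e, st_updA_take hL τ L le_rfl, clsA, Bool.and_eq_true, Nat.beq_eq, Nat.beq_eq, h3]
  dsimp only
  constructor
  · rintro ⟨-, h0⟩ a h
    have := h1 a
    rw [h0, Nat.zero_testBit] at this
    exact absurd h (by simpa using this)
  · intro h
    refine ⟨?_, Nat.zero_of_testBit_eq_false fun a => by rw [h1 a]; simpa using h a⟩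
    rw [Finset.card_eq_zero, onceSet, Finset.filter_eq_empty_iff]
    exact fun a _ => h a

end semantics

/-! ### §4 The class counted: self-avoiding words without a singleton axis -/

section theclass

variable {L : ℕ}

/-- NO SINGLETON AXIS, position form (manifestly a type invariant): every letter has another letter on its axis.
[cite: MadrasSlade1993, Definition 1.2.4] -/
def NoSingF {d : ℕ} (u : Word L d) : Prop := ∀ p : Fin L, ∃ q : Fin L, q ≠ p ∧ (u q).1 = (u p).1

/-- The total count on axis `a` is the number of positions on axis `a`. [cite: MadrasSlade1993, Definition 1.2.4] -/
theorem cntW_length (τ : Word L L) (a : ℕ) : cntW τ L a = (Finset.univ.filter fun p : Fin L => (τ p).1.val = a).card := by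
  unfold cntW; congr 1; ext p; simp

/-- ★ Position form = count form: no singleton axis iff no axis count equals one. [cite: MadrasSlade1993, Definition 1.2.4] -/
theorem noSingF_iff_cntW (τ : Word L L) : NoSingF τ ↔ ∀ a, cntW τ L a ≠ 1 := by
  constructor
  · intro h a ha
    rw [cntW_length, Finset.card_eq_one] at ha
    obtain ⟨p, hp⟩ := ha
    have hpm : p ∈ Finset.univ.filter fun q : Fin L => (τ q).1.val = a := by rw [hp]; exact Finset.mem_singleton_self p
    obtain ⟨q, hqp, hq⟩ := h p
    have hqm : q ∈ Finset.univ.filter fun q : Fin L => (τ q).1.val = a := by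
      rw [Finset.mem_filter] at hpm ⊢; exact ⟨Finset.mem_univ _, by rw [hq]; exact hpm.2⟩
    rw [hp, Finset.mem_singleton] at hqm
    exact hqp hqm
  · intro h p
    by_contra hne
    push Not at hne
    apply h (τ p).1.val
    rw [cntW_length, Finset.card_eq_one]
    refine ⟨p, Finset.eq_singleton_iff_unique_mem.2 ⟨by simp, fun q hq => ?_⟩⟩
    rw [Finset.mem_filter] at hq
    by_contra hqp
    exact hne q hqp (Fin.ext hq.2)

/-- Counts only grow along the word; the growth is the number of later letters on the axis. [cite: MadrasSlade1993, Definition 1.2.4] -/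
theorem cntW_length_eq_add (τ : Word L L) (i a : ℕ) :
    cntW τ L a = cntW τ i a + (Finset.univ.filter fun p : Fin L => i ≤ p.val ∧ (τ p).1.val = a).card := by
  rw [cntW_length, cntW, ← Finset.card_union_of_disjoint]
  · congr 1; ext p
    simp only [Finset.mem_filter, Finset.mem_univ, true_and, Finset.mem_union]
    constructor
    · intro h; rcases lt_or_ge p.val i with hp | hp; exacts [Or.inl ⟨hp, h⟩, Or.inr ⟨hp, h⟩]
    · rintro (⟨-, h⟩ | ⟨-, h⟩) <;> exact h
  · rw [Finset.disjoint_filter]; intro p _ h1 h2; omega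

/-- The positions from `i` on number `L − i`. [cite: MadrasSlade1993, Definition 1.2.4] -/
theorem card_filter_le_val {i : ℕ} (hi : i ≤ L) : (Finset.univ.filter fun p : Fin L => i ≤ p.val).card = L - i := by
  have hlt : (Finset.univ.filter fun p : Fin L => p.val < i).card = i := by
    rw [← Finset.card_range i]
    refine Finset.card_bij (fun p _ => p.val) (fun p hp => by simpa using hp) (fun p _ q _ h => Fin.ext h) (fun k hk => ?_)
    rw [Finset.mem_range] at hk
    exact ⟨⟨k, by omega⟩, by simp [hk], rfl⟩
  have hsum := Finset.card_filter_add_card_filter_not (s := (Finset.univ : Finset (Fin L))) (fun p : Fin L => p.val < i)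
  rw [hlt, Finset.card_univ, Fintype.card_fin] at hsum
  have e : (Finset.univ.filter fun p : Fin L => ¬ p.val < i) = Finset.univ.filter fun p : Fin L => i ≤ p.val :=
    Finset.filter_congr fun p _ => not_lt
  rw [e] at hsum
  omega

/-- ★ PIGEONHOLE: in a word without a singleton axis, after any prefix the singleton axes SO FAR are at most the letters to come (each needs one).
[cite: MadrasSlade1993, Definition 1.2.4] -/
theorem card_onceSet_le (τ : Word L L) (h : ∀ a, cntW τ L a ≠ 1) (i : ℕ) (hi : i ≤ L) : (onceSet τ i).card ≤ L - i := by
  classical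
  -- every singleton axis so far carries a later letter
  have hsub : onceSet τ i ⊆ (Finset.univ.filter fun p : Fin L => i ≤ p.val).image fun p => (τ p).1.val := by
    intro a ha
    rw [onceSet, Finset.mem_filter] at ha
    have hlater : 0 < (Finset.univ.filter fun p : Fin L => i ≤ p.val ∧ (τ p).1.val = a).card := by
      have h1 := cntW_length_eq_add τ i a
      have h2 := h a
      rw [ha.2] at h1
      by_contra h0
      have : (Finset.univ.filter fun p : Fin L => i ≤ p.val ∧ (τ p).1.val = a).card = 0 := by omega
      omega
    obtain ⟨p, hp⟩ := Finset.card_pos.1 hlater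
    rw [Finset.mem_filter] at hp
    exact Finset.mem_image.2 ⟨p, Finset.mem_filter.2 ⟨Finset.mem_univ _, hp.2.1⟩, hp.2.2⟩
  refine le_trans (Finset.card_le_card hsub) (le_trans Finset.card_image_le (le_of_eq (card_filter_le_val hi)))

/-- ★★★ THE RAW TESTS MEAN THE CLASS: for a word `τ` over `L ≤ 15` axes, «every prefix passes `okA` and the end state passes `clsA 0`» iff `τ` is
self-avoiding and has no singleton axis. [cite: MadrasSlade1993, Definition 1.2.4] -/
theorem prefixOK_clsA_iff (hL : L ≤ 15) (τ : Word L L) :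
    (PrefixOK updA okA (s0A L) τ ∧ clsA 0 (st updA (s0A L) (rawW τ)) = true) ↔ Percolation.IsSAW τ ∧ NoSingF τ := by
  rw [noSingF_iff_cntW, clsA_st_iff hL, isSAW_iff_blocks, ← prefixOK_iff_blocks]
  constructor
  · rintro ⟨hP, hC⟩
    exact ⟨fun i => ((okA_st_iff hL τ i.val (Nat.le_of_lt_succ i.isLt)).1 (hP i)).1, hC⟩
  · rintro ⟨hP, hC⟩
    exact ⟨fun i => (okA_st_iff hL τ i.val (Nat.le_of_lt_succ i.isLt)).2
      ⟨hP i, card_onceSet_le τ hC i.val (Nat.le_of_lt_succ i.isLt)⟩, hC⟩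

/-- ★ The class is a type invariant. [cite: MadrasSlade1993, Definition 1.2.4] -/
theorem isSAW_noSingF_iff_canon {d : ℕ} (u : Word L d) :
    (Percolation.IsSAW u ∧ NoSingF u) ↔ (Percolation.IsSAW (canon u) ∧ NoSingF (canon u)) := by
  have h := sameType_canon u
  rw [isSAW_iff_blocks, isSAW_iff_blocks]
  unfold bsumW NoSingF
  simp only [ne_eq, h.sum_eq_zero_iff, h.1 _ _]

/-- ★ The class is flip-invariant. [cite: MadrasSlade1993, Definition 1.2.4] -/
theorem isSAW_noSingF_flipW_iff (S : Finset (Fin L)) (τ : Word L L) :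
    (Percolation.IsSAW (flipW S τ) ∧ NoSingF (flipW S τ)) ↔ (Percolation.IsSAW τ ∧ NoSingF τ) := by
  rw [isSAW_iff_blocks, isSAW_iff_blocks]
  unfold bsumW NoSingF
  simp only [ne_eq, sum_flipW_eq_zero_iff, flipW_fst]

open Classical in
/-- ★★★ **THE NO-SINGLETON CENSUS IN EVERY DIMENSION**: the `L`-step self-avoiding words of `ℤ^d` without a singleton axis number
`Σ_{k ≤ L} 2^k a_k d^{(k)}` with `a_k = dfsN alwR updA okA clsA 0 k L (s0A L) 0` the lean machine's reduced counts (`L ≤ 15`).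
[cite: MadrasSlade1993, Definition 1.2.4] -/
theorem card_isSAW_noSingF_eq_sum {d : ℕ} (hL : L ≤ 15) (n : ℕ → ℕ) (hn : ∀ k, k ≤ L → dfsN alwR updA okA clsA 0 k L (s0A L) 0 = n k) :
    (Finset.univ.filter fun u : Word L d => Percolation.IsSAW u ∧ NoSingF u).card =
      ∑ k ∈ Finset.range (L + 1), 2 ^ k * n k * d.descFactorial k :=
  card_eq_sum_dfsN_reduced updA okA clsA (s0A L) 0 (fun u : Word L d => Percolation.IsSAW u ∧ NoSingF u)
    (fun u => by rw [isSAW_noSingF_iff_canon, prefixOK_clsA_iff hL]) (fun S τ => by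
      rw [prefixOK_clsA_iff hL, prefixOK_clsA_iff hL, isSAW_noSingF_flipW_iff]) n hn

/-- ★ THE DIGITS OF THE LEAN CENSUS VALUE: if `fastAS B L (s0A L) 0 = Nat.ofDigits B tab` for a table of `L + 1` entries `< B` with `(2L)^L < B`, the reduced
counts are the table entries. [cite: MadrasSlade1993, Definition 1.2.4] -/
theorem dfsN_A_of_table (L B : ℕ) (hB : (2 * L) ^ L < B) (tab : List ℕ) (hlen : tab.length = L + 1)
    (hlt : ∀ x ∈ tab, x < B) (hV : fastAS B L (s0A L) 0 = Nat.ofDigits B tab) (k : ℕ) (hk : k ≤ L) :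
    dfsN alwR updA okA clsA 0 k L (s0A L) 0 = tab.getD k 0 := by
  have hV' : dfsV alwR updA okA clsA 1 (L + 1) B L (s0A L) 0 = Nat.ofDigits (B ^ (L + 1)) ([tab].map (Nat.ofDigits B)) := by
    rw [← fastAS_eq_dfsV, hV]; simp
  have h := dfsN_eq_of_table alwR updA okA clsA (s0A L) hB [tab] rfl (fun r hr => by simp only [List.mem_singleton] at hr; rw [hr, hlen])
    (fun r hr x hx => by simp only [List.mem_singleton] at hr; rw [hr] at hx; exact hlt x hx) hV' (c := 0) (k := k) Nat.one_pos hk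
  simpa using h

open Classical in
/-- ★★★ **THE NO-SINGLETON CENSUS FROM ONE LEAN CENSUS VALUE**: `#{u : Word L d | SAW, no singleton axis} = Σ_{k<L+1} 2^k · tab[k] · d^{(k)}`.
[cite: MadrasSlade1993, Definition 1.2.4] -/
theorem card_isSAW_noSingF_of_fastAS {d : ℕ} (L : ℕ) (hL : L ≤ 15) (B : ℕ) (hB : (2 * L) ^ L < B) (tab : List ℕ) (hlen : tab.length = L + 1)
    (hlt : ∀ x ∈ tab, x < B) (hV : fastAS B L (s0A L) 0 = Nat.ofDigits B tab) :
    (Finset.univ.filter fun u : Word L d => Percolation.IsSAW u ∧ NoSingF u).card =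
      ∑ k ∈ Finset.range (L + 1), 2 ^ k * tab.getD k 0 * d.descFactorial k :=
  card_isSAW_noSingF_eq_sum hL (fun k => tab.getD k 0) (fun k hk => dfsN_A_of_table L B hB tab hlen hlt hV k hk)

end theclass

/-! ### §5 Assembly by table: a census value evaluated in pieces (as in `…ZdBridgeFast` §4) -/

section assembly

/-- ★ THE TABLE-DRIVEN EVALUATOR of the no-singleton machine: the reduced search from the root by raw prefixes, reading the value of any prefix found
in the table `T` (as `Nat.ofDigits B digits`) instead of searching below it. [cite: MadrasSlade1993, Definition 1.2.4] -/
def fastAT (T : List (List (ℕ × Bool) × ℕ × ℕ × List ℕ)) (B : ℕ) (s₀ : FA) : ℕ → List (ℕ × Bool) → ℕ → ℕ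
  | 0, w, m => fastAS B 0 (st updA s₀ w) m
  | j + 1, w, m =>
    match lookupT T w with
    | some ds => Nat.ofDigits B ds
    | none =>
      bif okA (st updA s₀ w) then
        sumTo (fun a => fastAT T B s₀ j (w ++ [(a, true)]) m + fastAT T B s₀ j (w ++ [(a, false)]) m) m +
          fastAT T B s₀ j (w ++ [(m, true)]) (m + 1)
      else 0

/-- One level of `fastAS` below a live state, child by child. [cite: MadrasSlade1993, Definition 1.2.4] -/
theorem fastAS_succ (B j : ℕ) (s : FA) (m : ℕ) (h : okA s = true) :
    fastAS B (j + 1) s m =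
      sumTo (fun a => fastAS B j (updA s (a, true)) m + fastAS B j (updA s (a, false)) m) m + fastAS B j (updA s (m, true)) (m + 1) := by
  have hok : (!memM s.key s.mask s.vis && Nat.ble s.c1 s.tg) = okA s := rfl
  rw [fastAS, fastA, hok, h, cond_true]
  have hch : ∀ (a : ℕ) (b : Bool) (m' : ℕ), fastAS B j (updA s (a, b)) m' =
      fastA B j (bif b then s.key + 32 ^ a else s.key - 32 ^ a) (Nat.lor s.mask (slot s.key)) (s.key :: s.vis) m'
        (stepA s.once s.multi s.c1 a).1 (stepA s.once s.multi s.c1 a).2.1 (stepA s.once s.multi s.c1 a).2.2 (s.tg - 1) := by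
    intro a b m'; cases b <;> simp [fastAS, updA, newKey]
  simp only [hch, cond_true, cond_false]

/-- Zero letters to go: `fastAS` does not see the table. [cite: MadrasSlade1993, Definition 1.2.4] -/
theorem fastAT_zero (T : List (List (ℕ × Bool) × ℕ × ℕ × List ℕ)) (B : ℕ) (s₀ : FA) (w : List (ℕ × Bool)) (m : ℕ) :
    fastAT T B s₀ 0 w m = fastAS B 0 (st updA s₀ w) m := rfl

/-- ★★ SOUNDNESS OF THE TABLE: if every entry `(w, j, m, digits)` of `T` is TRUE — `fastAS B j (st updA s₀ w) m = Nat.ofDigits B digits` with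
`|w| + j = L` and `m` the axis count of `w` — then the table-driven value from any prefix is the true value. [cite: MadrasSlade1993, Definition 1.2.4] -/
theorem fastAT_eq (T : List (List (ℕ × Bool) × ℕ × ℕ × List ℕ)) (B : ℕ) (s₀ : FA) (L : ℕ)
    (hT : ∀ e ∈ T, e.1.length + e.2.1 = L ∧ naxL 0 e.1 = e.2.2.1 ∧ fastAS B e.2.1 (st updA s₀ e.1) e.2.2.1 = Nat.ofDigits B e.2.2.2) :
    ∀ (j : ℕ) (w : List (ℕ × Bool)), w.length + j = L → fastAT T B s₀ j w (naxL 0 w) = fastAS B j (st updA s₀ w) (naxL 0 w) := by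
  intro j
  induction j with
  | zero => intro w _; rfl
  | succ j ih =>
    intro w hw
    rw [fastAT]
    cases hl : lookupT T w with
    | some ds =>
      simp only
      obtain ⟨j', m', hmem⟩ := exists_mem_of_lookupT T w ds hl
      obtain ⟨h1, h2, h3⟩ := hT _ hmem
      simp only at h1 h2 h3
      obtain rfl : j' = j + 1 := by omega
      rw [← h2] at h3
      exact h3.symm
    | none =>
      simp only
      cases hok : okA (st updA s₀ w)
      · have : fastAS B (j + 1) (st updA s₀ w) (naxL 0 w) = 0 := by
          have hok' : (!memM (st updA s₀ w).key (st updA s₀ w).mask (st updA s₀ w).vis &&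
              Nat.ble (st updA s₀ w).c1 (st updA s₀ w).tg) = false := hok
          rw [fastAS, fastA, hok', cond_false]
        rw [this]; rfl
      · rw [cond_true, fastAS_succ B j _ _ hok]
        have hch : ∀ a : ℕ × Bool, fastAT T B s₀ j (w ++ [a]) (naxL 0 (w ++ [a])) = fastAS B j (updA (st updA s₀ w) a) (naxL 0 (w ++ [a])) := by
          intro a
          rw [ih (w ++ [a]) (by simp; omega), st_append_singleton]
        have hn : ∀ a : ℕ × Bool, naxL 0 (w ++ [a]) = nxt (naxL 0 w) a := fun a => naxL_append_singleton 0 w a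
        set m := naxL 0 w with hm
        have hnew := hch (m, true)
        rw [hn, nxt_self] at hnew
        rw [hnew, sumTo_congr (g := fun a => fastAS B j (updA (st updA s₀ w) (a, true)) m +
            fastAS B j (updA (st updA s₀ w) (a, false)) m) (fun a ha => by
          have hp := hch (a, true)
          have hq := hch (a, false)
          rw [hn, nxt_of_lt ha] at hp hq
          rw [hp, hq])]

/-- ★★★ THE ROOT VALUE FROM THE TABLE: with a true table, `fastAS B L (s0A L) 0 = fastAT T B (s0A L) L [] 0`. [cite: MadrasSlade1993, Definition 1.2.4] -/
theorem fastAS_root_eq_fastAT (T : List (List (ℕ × Bool) × ℕ × ℕ × List ℕ)) (B L : ℕ)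
    (hT : ∀ e ∈ T, e.1.length + e.2.1 = L ∧ naxL 0 e.1 = e.2.2.1 ∧ fastAS B e.2.1 (st updA (s0A L) e.1) e.2.2.1 = Nat.ofDigits B e.2.2.2) :
    fastAS B L (s0A L) 0 = fastAT T B (s0A L) L [] 0 := by
  have h := fastAT_eq T B (s0A L) L hT L [] (by simp)
  exact h.symm

/-- A table hypothesis from its shape check (decidable) and the cell theorems. [cite: MadrasSlade1993, Definition 1.2.4] -/
theorem tableA_ok_of {T : List (List (ℕ × Bool) × ℕ × ℕ × List ℕ)} {B : ℕ} {s₀ : FA} {L : ℕ}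
    (hshape : (T.all fun e => e.1.length + e.2.1 == L && naxL 0 e.1 == e.2.2.1) = true)
    (hcells : ∀ e ∈ T, fastAS B e.2.1 (st updA s₀ e.1) e.2.2.1 = Nat.ofDigits B e.2.2.2) :
    ∀ e ∈ T, e.1.length + e.2.1 = L ∧ naxL 0 e.1 = e.2.2.1 ∧ fastAS B e.2.1 (st updA s₀ e.1) e.2.2.1 = Nat.ofDigits B e.2.2.2 := by
  intro e he
  have h := List.all_eq_true.1 hshape e he
  simp only [Bool.and_eq_true, beq_iff_eq] at h
  exact ⟨h.1, h.2, hcells e he⟩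

end assembly

/-! ### §6 Self-test in every dimension: the six-step words without a singleton axis number `2d + 348 d(d−1) + 504 d(d−1)(d−2)` -/

/-- The lean census value of the no-singleton six-step words: reduced counts `(0, 1, 87, 63, 0, 0, 0)` by number of axes. [cite: MadrasSlade1993, Definition 1.2.4] -/
theorem fastAS_six : fastAS 16777216 6 (s0A 6) 0 = Nat.ofDigits 16777216 [0, 1, 87, 63, 0, 0, 0] := by
  decide +kernel

open Classical in
/-- ★ SELF-TEST: `#{six-step SAWs of ℤ^d with no axis used exactly once} = 2d + 348 d(d−1) + 504 d(d−1)(d−2)` for every `d`.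
[cite: MadrasSlade1993, Definition 1.2.4] -/
theorem card_isSAW_noSingF_six (d : ℕ) :
    (Finset.univ.filter fun u : Word 6 d => Percolation.IsSAW u ∧ NoSingF u).card =
      2 * d.descFactorial 1 + 348 * d.descFactorial 2 + 504 * d.descFactorial 3 := by
  rw [card_isSAW_noSingF_of_fastAS 6 (by norm_num) 16777216 (by norm_num) _ rfl (by decide) fastAS_six]
  simp [Finset.sum_range_succ]


end WordTypes

end Literature.Probability.RandomPlanarGeometry.SAW.Zd
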